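import Summits.BirchSwinnertonDyer.BirchSwinnertonDyer.Theorems.PrintCf2RamifiedOffTYZGenusPeriodKummer
import HarnessLib

/-!
# C⁺ ON R2 IN KUMMER-CLASS CURRENCY: the visible rows read the class of `Z(lq)`, the invisible rows read the class of a HALF of `Z(lq)`
# (crux stmt-BirchSwinnertonDyer-20509 `RamifiedOffTYZOfFacts`, line `offtyz-v7`, LEAD cruxlead-20509 g28, lineage cycle 29, part 2)

HONEST FRAMING (cell `bsd-print-cf2`, route `PrintCf2`; `--supports stmt-BirchSwinnertonDyer-20509`; theorems only, `def`-free, no named fact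
introduced, no `sorry`).  BSD is not proved by any of this; no class is closed by this file; item 23431 (C⁺) and crux 20509 stay OPEN.

Part 1 (p795970, `…GenusPeriodKummer`) turned «`R ∈ 2A(ℍ′) + tors`» into a statement about the two complete-`2`-descent classes `([X(R)], [X(R) − 2i])`
of `ℍ′_n` and the four torsion classes.  g26's `GenusPeriodR2.levelTwo_iff_genusPeriod_R2` (p789339) reads C⁺ at `lq` as «depth `Z(lq)` = [`X(h) ∈ 2ℚ^{×2}`]».
This file composes the two BY NAME, so that every clause of C⁺|R2 is a statement about NAMED square classes — the currency of the cycle-29 instruments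
(`zclass.py`: LAW Z⁺ `κ(Z(lq)) = (1, [π_l]^{[¬S]}[β_l]^{[δ(l)]})`, 150/150; `zgen.py`: the classes of the halves and of the generator-side points):

* §1 (fact-free group bookkeeping on `A(ℍ′_n)`): `fourDivisible_modTorsion_iff_half` — if `Z − 2Y` is torsion then **`Z ∈ 4A + tors ⟺ Y ∈ 2A + tors`** (all
  halves of `Z` modulo torsion differ by torsion); hence the exact-depth clause of C⁺ is a statement about the Kummer class of ANY half `Y`.
* §2 ★★ `levelTwo_iff_kummer_of_visible` — visible generator (`X(h) ∉ 2ℚ^{×2}`): **C⁺ at `lq` ⟺ the Kummer class of `Z(lq)` is NOT one of the four torsion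
  classes** (so, under LAW Z⁺ with independence, ⟺ the row is off the cell `S ∧ x32` — part 1 `levelTwo_of_lawZPlus_of_visible`).
* §4 (appended) ★★★ `levelTwo_R2_of_kummerLaws` — C⁺ at an R2 row from the LAW Z⁺ shape + visibility off the cell + the second-digit class on the cell.
* §3 ★★ `levelTwo_iff_kummer_half_of_invisible` — invisible generator (`X(h) = 2s²`) on the `¬δ(l)` rows: **C⁺ at `lq` ⟺ `Z(lq)` has a half `Y` modulo torsion
  AND the Kummer class of `Y` is not a torsion class**; ★★ `levelTwo_of_half_class_of_invisible` — the usable direction with the class of `Y` in LAW shape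
  `[c]` / `[i c]`, `[X(Y)]`-component free: if `[c̃] ∉ {1,[i]}` for the relevant component then C⁺ (instrument, cell `S ∧ x32 ∧ ¬T`: `κ(½(Z+t)) = ([ω̄_K], …)`,
  first component `[ω̄_K] ≠ 1, [i]` — the generator of the principal power of the conjugate LEVEL PRIME enters at the second digit).

References: [cite: SilvermanAEC2009, Prop. X.1.4]; [cite: TianYuanZhang2017, §3.1, Thm. 3.5, Lemma 3.18 (p0017 L152–L153), Thm. 1.2]; [cite: BurungaleFlach2024, Thm 1.1 / Cor. 3];
[cite: Darmon2004, Thm. 3.22]; tree: part 1 (p795970), g26 `…GenusPeriodR2` (p789339).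
-/

noncomputable section

open scoped Classical

open WeierstrassCurve WeierstrassCurve.Affine WeierstrassCurve.Affine.Point
  Literature.NumberTheory.EllipticCurves Literature.NumberTheory.EllipticCurves.Rank1Residual
  Summit.BirchSwinnertonDyer.Rank1Residual
  Literature.NumberTheory.EllipticCurves.TianYuanZhang2017
  Literature.NumberTheory.EllipticCurves.TianYuanZhang2017.W2
  Summit.BirchSwinnertonDyer.PrintCf2.VisibleGenerator
  Summit.BirchSwinnertonDyer.PrintCf2.GenusPeriodKummer

set_option autoImplicit false

namespace Summit.BirchSwinnertonDyer.PrintCf2.GenusPeriodKummerR2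

variable {n : ℕ}

/-! ## §1 Halves modulo torsion differ by torsion; `Z ∈ 4A + tors` ⟺ a half is in `2A + tors` (fact-free) -/

/-- Two halves of the same point modulo torsion differ by a torsion point: `Z − 2Y`, `Z − 2Y′` torsion ⟹ `Y − Y′` torsion. [folklore] -/
theorem isOfFinAddOrder_sub_of_halves {G : Type*} [AddCommGroup G] {Z Y Y' : G}
    (hY : IsOfFinAddOrder (Z - (2 : ℤ) • Y)) (hY' : IsOfFinAddOrder (Z - (2 : ℤ) • Y')) : IsOfFinAddOrder (Y - Y') := by
  have h2 : IsOfFinAddOrder ((2 : ℕ) • (Y - Y')) := by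
    have : (2 : ℕ) • (Y - Y') = (Z - (2 : ℤ) • Y') - (Z - (2 : ℤ) • Y) := by
      rw [two_nsmul, two_zsmul, two_zsmul]; abel
    rw [this, sub_eq_add_neg]; exact hY'.add hY.neg
  exact (isOfFinAddOrder_nsmul.mp h2).resolve_right two_ne_zero

/-- **`Z ∈ 4A + tors ⟺ Y ∈ 2A + tors` for any half `Y` of `Z` modulo torsion** (any abelian group). [folklore] -/
theorem fourDivisible_modTorsion_iff_half {G : Type*} [AddCommGroup G] {Z Y : G} (hY : IsOfFinAddOrder (Z - (2 : ℤ) • Y)) :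
    (∃ y : G, IsOfFinAddOrder (Z - (4 : ℤ) • y)) ↔ ∃ y : G, IsOfFinAddOrder (Y - (2 : ℤ) • y) := by
  constructor
  · rintro ⟨y, hy⟩
    have hY' : IsOfFinAddOrder (Z - (2 : ℤ) • ((2 : ℤ) • y)) := by rwa [smul_smul, show (2 : ℤ) * 2 = 4 by norm_num]
    have ht := isOfFinAddOrder_sub_of_halves hY hY'
    exact ⟨y, ht⟩
  · rintro ⟨y, hy⟩
    refine ⟨y, ?_⟩
    have : Z - (4 : ℤ) • y = (Z - (2 : ℤ) • Y) + (2 : ℕ) • (Y - (2 : ℤ) • y) := by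
      rw [two_nsmul, show (4 : ℤ) • y = (2 : ℤ) • y + (2 : ℤ) • y by rw [← add_zsmul]; norm_num]; abel
    rw [this]; exact hY.add (hy.nsmul)

/-! ## §2 Visible rows: C⁺ ⟺ the Kummer class of `Z(lq)` is not a torsion class -/

/-- ★★ **C⁺ AT `lq` ON A VISIBLE ROW ⟺ THE KUMMER CLASS OF THE GENUS PERIOD IS NOT A TORSION CLASS.**  Granted conjuncts 1, 2, 4, 5 of 𝔅_ram;
primes `l ≡ 1`, `q ≡ 7 (mod 8)`, `n = lq`, `ord_{s=1} L(E_n, s) = 1`; a display package `D` (`Printed`, CM-point layer, Thm 3.5 at blocks); a VISIBLE generator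
`h = (X, Y)` of `A_n(ℚ)` modulo torsion (`X ∉ 2ℚ^{×2}`).  Then `2 ∥ L` for all `L` with `𝓛(n)² = L²` **iff** the pair `([X(Z(n))], [X(Z(n)) − 2i])` of descent
classes is NOT in `{(1,1), (1,[i]), ([i],[1+i]), ([i],[i(1+i)])}`. [cite: TianYuanZhang2017, §3.1, Thm. 3.5, Lemma 3.18, Thm. 1.2] [cite: SilvermanAEC2009, Prop. X.1.4]
[cite: BurungaleFlach2024, Thm 1.1 / Cor. 3] [cite: Darmon2004, Thm. 3.22] -/
theorem levelTwo_iff_kummer_of_visible (hGZK : rank_eq_analyticRank_of_analyticRank_le_one)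
    (hmod : WeierstrassCurve.hasEntireLFunction_rat) (hCM0 : bsdTriple_of_hasCM_of_L_one_ne_zero) (h12 : thm12_parity_of_scriptL')
    {l q : ℕ} (hl : l.Prime) (hq : q.Prime) (hl8 : l % 8 = 1) (hq8 : q % 8 = 7) (hn : n = l * q)
    (hr : (congruentNumberCurve n).analyticRank = 1)
    (D : GenusPointData n) (hPr : D.Printed) (hC : D.CMPointCompositumPrinted) (hBl : D.Thm35AtBlocks)
    {X Y : ℚ} (h : (Atwo n).toAffine.Nonsingular X Y) (hX : ¬ ∃ s : ℚ, X = 2 * s ^ 2)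
    (hgen : ∀ P : (Atwo n).toAffine.Point, ∃ m : ℤ, IsOfFinAddOrder (P - m • (Point.some X Y h : (Atwo n).toAffine.Point))) :
    (∀ L : ℤ, IsScriptL n L → (2 : ℤ) ∣ L ∧ ¬ (4 : ℤ) ∣ L) ↔
      ¬ ((twoDescentComponent (curveA.baseChange D.H).toAffine 0 (2 * D.im) (-(2 * D.im)) (D.Z n) = 1 ∧
            (twoDescentComponent (curveA.baseChange D.H).toAffine (2 * D.im) 0 (-(2 * D.im)) (D.Z n) = 1 ∨
              twoDescentComponent (curveA.baseChange D.H).toAffine (2 * D.im) 0 (-(2 * D.im)) (D.Z n) = sqClass D.im)) ∨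
          (twoDescentComponent (curveA.baseChange D.H).toAffine 0 (2 * D.im) (-(2 * D.im)) (D.Z n) = sqClass D.im ∧
            (twoDescentComponent (curveA.baseChange D.H).toAffine (2 * D.im) 0 (-(2 * D.im)) (D.Z n) = sqClass (1 + D.im) ∨
              twoDescentComponent (curveA.baseChange D.H).toAffine (2 * D.im) 0 (-(2 * D.im)) (D.Z n) =
                sqClass (D.im * (1 + D.im))))) := by
  have hodd : Odd n := by
    rw [hn, Nat.odd_mul]; exact ⟨Nat.odd_iff.mpr (by omega), Nat.odd_iff.mpr (by omega)⟩
  rw [GenusPeriodR2.levelTwo_iff_genusPeriod_not_twoDivisible_of_visible hGZK hmod hCM0 h12 hl hq hl8 hq8 hn hr D hPr hC hBl h hX hgen,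
    twoDivisible_modTorsion_iff_sqClass D hodd hPr.2.2.2.2.2.2.2.2.1]

/-! ## §3 Invisible rows (`X(h) = 2s²`, digit `¬δ(l)`): C⁺ ⟺ `Z(lq)` has a half whose Kummer class is not a torsion class -/

/-- ★★ **C⁺ AT `lq` ON AN INVISIBLE `¬δ(l)` ROW ⟺ `Z(lq)` IS HALVABLE MODULO TORSION AND THE HALF'S KUMMER CLASS IS NOT A TORSION CLASS.**  Same hypotheses
with an INVISIBLE generator `X = 2s²` and `¬δ(l)` (`ord L(E_l) ≥ 2`, or `= 0` with `#Sel₄(E_l) ≠ 2⁴`).  [cite: TianYuanZhang2017, §3.1, Thm. 3.5, Lemma 3.18, Thm. 1.2]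
[cite: SilvermanAEC2009, Prop. X.1.4] [cite: BurungaleFlach2024, Thm 1.1 / Cor. 3] [cite: Darmon2004, Thm. 3.22] -/
theorem levelTwo_iff_kummer_half_of_invisible (hGZK : rank_eq_analyticRank_of_analyticRank_le_one)
    (hmod : WeierstrassCurve.hasEntireLFunction_rat) (hCM0 : bsdTriple_of_hasCM_of_L_one_ne_zero) (h12 : thm12_parity_of_scriptL')
    {l q : ℕ} (hl : l.Prime) (hq : q.Prime) (hl8 : l % 8 = 1) (hq8 : q % 8 = 7) (hn : n = l * q)
    (hr : (congruentNumberCurve n).analyticRank = 1)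
    (D : GenusPointData n) (hPr : D.Printed) (hC : D.CMPointCompositumPrinted) (hBl : D.Thm35AtBlocks)
    {X Y : ℚ} (h : (Atwo n).toAffine.Nonsingular X Y) (hX : ∃ s : ℚ, X = 2 * s ^ 2)
    (hgen : ∀ P : (Atwo n).toAffine.Point, ∃ m : ℤ, IsOfFinAddOrder (P - m • (Point.some X Y h : (Atwo n).toAffine.Point)))
    (hδ : ¬ ((congruentNumberCurve l).analyticRank = 0 ∧ Nat.card ((congruentNumberCurve l).selmerGroup 4) = 2 ^ 4)) :
    (∀ L : ℤ, IsScriptL n L → (2 : ℤ) ∣ L ∧ ¬ (4 : ℤ) ∣ L) ↔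
      ∃ W : APoint D.H, IsOfFinAddOrder (D.Z n - (2 : ℤ) • W) ∧
        ¬ ((twoDescentComponent (curveA.baseChange D.H).toAffine 0 (2 * D.im) (-(2 * D.im)) W = 1 ∧
              (twoDescentComponent (curveA.baseChange D.H).toAffine (2 * D.im) 0 (-(2 * D.im)) W = 1 ∨
                twoDescentComponent (curveA.baseChange D.H).toAffine (2 * D.im) 0 (-(2 * D.im)) W = sqClass D.im)) ∨
            (twoDescentComponent (curveA.baseChange D.H).toAffine 0 (2 * D.im) (-(2 * D.im)) W = sqClass D.im ∧
              (twoDescentComponent (curveA.baseChange D.H).toAffine (2 * D.im) 0 (-(2 * D.im)) W = sqClass (1 + D.im) ∨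
                twoDescentComponent (curveA.baseChange D.H).toAffine (2 * D.im) 0 (-(2 * D.im)) W = sqClass (D.im * (1 + D.im))))) := by
  have hodd : Odd n := by
    rw [hn, Nat.odd_mul]; exact ⟨Nat.odd_iff.mpr (by omega), Nat.odd_iff.mpr (by omega)⟩
  have h318 : D.lemma318 := hPr.2.2.2.2.2.2.2.2.1
  rw [GenusPeriodR2.levelTwo_iff_genusPeriod_R2 hGZK hmod hCM0 h12 hl hq hl8 hq8 hn hr D hPr hC hBl h hgen hδ]
  constructor
  · rintro (⟨-, ⟨W, hW⟩, h4⟩ | ⟨hX', -⟩)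
    · refine ⟨W, hW, ?_⟩
      rw [← twoDivisible_modTorsion_iff_sqClass D hodd h318 W, ← fourDivisible_modTorsion_iff_half hW]
      exact h4
    · exact absurd hX hX'
  · rintro ⟨W, hW, hcl⟩
    refine Or.inl ⟨hX, ⟨W, hW⟩, ?_⟩
    rw [fourDivisible_modTorsion_iff_half hW, twoDivisible_modTorsion_iff_sqClass D hodd h318 W]
    exact hcl

/-- ★★ **THE USABLE DIRECTION ON THE INVISIBLE CELL.**  Same hypotheses; if some half `W` of `Z(lq)` modulo torsion (`Z − 2W` torsion) has FIRST descent class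
`[X(W)] ∉ {1, [i]}` — the instrument's reading on the cell `S ∧ x32 ∧ ¬T`: `[X(½(Z + t))] = [ω̄_K]`, `ω̄_K` a generator of the principal power of the conjugate
Heegner level prime of `K = ℚ(√−lq)`, not in `⟨ℍ′^{×2}, i⟩` — then **`2 ∥ L` for all `L` with `𝓛(n)² = L²`**. [cite: TianYuanZhang2017, §3.1, Thm. 3.5, Lemma 3.18, Thm. 1.2]
[cite: SilvermanAEC2009, Prop. X.1.4] [cite: BurungaleFlach2024, Thm 1.1 / Cor. 3] [cite: Darmon2004, Thm. 3.22] -/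
theorem levelTwo_of_half_class_of_invisible (hGZK : rank_eq_analyticRank_of_analyticRank_le_one)
    (hmod : WeierstrassCurve.hasEntireLFunction_rat) (hCM0 : bsdTriple_of_hasCM_of_L_one_ne_zero) (h12 : thm12_parity_of_scriptL')
    {l q : ℕ} (hl : l.Prime) (hq : q.Prime) (hl8 : l % 8 = 1) (hq8 : q % 8 = 7) (hn : n = l * q)
    (hr : (congruentNumberCurve n).analyticRank = 1)
    (D : GenusPointData n) (hPr : D.Printed) (hC : D.CMPointCompositumPrinted) (hBl : D.Thm35AtBlocks)
    {X Y : ℚ} (h : (Atwo n).toAffine.Nonsingular X Y) (hX : ∃ s : ℚ, X = 2 * s ^ 2)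
    (hgen : ∀ P : (Atwo n).toAffine.Point, ∃ m : ℤ, IsOfFinAddOrder (P - m • (Point.some X Y h : (Atwo n).toAffine.Point)))
    (hδ : ¬ ((congruentNumberCurve l).analyticRank = 0 ∧ Nat.card ((congruentNumberCurve l).selmerGroup 4) = 2 ^ 4))
    {W : APoint D.H} (hW : IsOfFinAddOrder (D.Z n - (2 : ℤ) • W))
    (h1 : twoDescentComponent (curveA.baseChange D.H).toAffine 0 (2 * D.im) (-(2 * D.im)) W ≠ 1)
    (hi : twoDescentComponent (curveA.baseChange D.H).toAffine 0 (2 * D.im) (-(2 * D.im)) W ≠ sqClass D.im) :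
    ∀ L : ℤ, IsScriptL n L → (2 : ℤ) ∣ L ∧ ¬ (4 : ℤ) ∣ L :=
  (levelTwo_iff_kummer_half_of_invisible hGZK hmod hCM0 h12 hl hq hl8 hq8 hn hr D hPr hC hBl h hX hgen hδ).mpr
    ⟨W, hW, fun hc => hc.elim (fun hc => h1 hc.1) (fun hc => hi hc.1)⟩

/-! ## §4 (appended, cycle 29 part 3) C⁺ AT AN R2 ROW FROM THE KUMMER LAWS, BY CELLS — LAW Z⁺ shape + visibility off the cell + second digit on the cell -/

/-- ★★★ **C⁺ AT `lq` FROM THE KUMMER LAWS OF CYCLE 29, BY CELLS.**  Granted conjuncts 1, 2, 4, 5 of 𝔅_ram; primes `l ≡ 1`, `q ≡ 7 (mod 8)`, `n = lq`,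
`ord_{s=1} L(E_n, s) = 1`; a display package `D` (`Printed`, CM-point layer, Thm 3.5 at blocks) with `ζ₈ ∉ ℍ′_n`; a generator `h = (X, Y)` of `A_n(ℚ)` modulo torsion;
two INDEPENDENT elements `p, b ∈ ℍ′_n` (classes of `p`, `b`, `pb` outside `{1, [i]}` — for R2: `π_l`, `β_l`) and bits `e₁ e₂` such that the genus period has the
LAW Z⁺ shape `κ(Z(n)) = (1, [p^{e₁} b^{e₂}])` up to `[i]` (instrument: `e₁ = [S = −1]`, `e₂ = [l ≠ x² + 32y²]`, 165/165).  If moreover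
(i) OFF the cell `(e₁, e₂) = (0,0)` the generator is VISIBLE (`X ∉ 2ℚ^{×2}` — LAW V's easy half), and
(ii) ON the cell, `¬δ(l)`, the generator is INVISIBLE (`X = 2s²`) and some half `W` of `Z(n)` modulo torsion has first descent class `[X(W)] ∉ {1, [i]}`
(the SECOND-DIGIT law: `[X(W)] = [ω_K]` on the sub-cell `T = −1`; the sub-cell `T = +1` is excluded upstream by `#Sel₄ = 2⁶`, LAW S),
then **`2 ∥ L` for every `L` with `𝓛(n)² = L²`.**  (Visible rows: part 1 `levelTwo_of_lawZPlus_of_visible`; the cell: §3 `levelTwo_of_half_class_of_invisible`.)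
[cite: TianYuanZhang2017, §1, §3.1, Thm. 3.5, Lemma 3.18, Thm. 1.2] [cite: SilvermanAEC2009, Prop. X.1.4] [cite: BurungaleFlach2024, Thm 1.1 / Cor. 3] [cite: Darmon2004, Thm. 3.22] -/
theorem levelTwo_R2_of_kummerLaws (hGZK : rank_eq_analyticRank_of_analyticRank_le_one)
    (hmod : WeierstrassCurve.hasEntireLFunction_rat) (hCM0 : bsdTriple_of_hasCM_of_L_one_ne_zero) (h12 : thm12_parity_of_scriptL')
    {l q : ℕ} (hl : l.Prime) (hq : q.Prime) (hl8 : l % 8 = 1) (hq8 : q % 8 = 7) (hn : n = l * q)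
    (hr : (congruentNumberCurve n).analyticRank = 1)
    (D : GenusPointData n) (hPr : D.Printed) (hC : D.CMPointCompositumPrinted) (hBl : D.Thm35AtBlocks) (hi8 : sqClass D.im ≠ 1)
    {X Y : ℚ} (h : (Atwo n).toAffine.Nonsingular X Y)
    (hgen : ∀ P : (Atwo n).toAffine.Point, ∃ m : ℤ, IsOfFinAddOrder (P - m • (Point.some X Y h : (Atwo n).toAffine.Point)))
    {p b : D.H} (hp0 : p ≠ 0) (hb0 : b ≠ 0)
    (hp : sqClass p ≠ 1 ∧ sqClass p ≠ sqClass D.im) (hb : sqClass b ≠ 1 ∧ sqClass b ≠ sqClass D.im)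
    (hpb : sqClass (p * b) ≠ 1 ∧ sqClass (p * b) ≠ sqClass D.im) (e₁ e₂ : Bool)
    (hlaw : twoDescentComponent (curveA.baseChange D.H).toAffine 0 (2 * D.im) (-(2 * D.im)) (D.Z n) = 1 ∧
      (twoDescentComponent (curveA.baseChange D.H).toAffine (2 * D.im) 0 (-(2 * D.im)) (D.Z n) =
          sqClass ((if e₁ then p else 1) * (if e₂ then b else 1)) ∨
        twoDescentComponent (curveA.baseChange D.H).toAffine (2 * D.im) 0 (-(2 * D.im)) (D.Z n) =
          sqClass (D.im * ((if e₁ then p else 1) * (if e₂ then b else 1)))))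
    (hvis : ¬ (e₁ = false ∧ e₂ = false) → ¬ ∃ s : ℚ, X = 2 * s ^ 2)
    (hcell : (e₁ = false ∧ e₂ = false) →
      ¬ ((congruentNumberCurve l).analyticRank = 0 ∧ Nat.card ((congruentNumberCurve l).selmerGroup 4) = 2 ^ 4) ∧
      (∃ s : ℚ, X = 2 * s ^ 2) ∧
      ∃ W : APoint D.H, IsOfFinAddOrder (D.Z n - (2 : ℤ) • W) ∧
        twoDescentComponent (curveA.baseChange D.H).toAffine 0 (2 * D.im) (-(2 * D.im)) W ≠ 1 ∧
        twoDescentComponent (curveA.baseChange D.H).toAffine 0 (2 * D.im) (-(2 * D.im)) W ≠ sqClass D.im) :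
    ∀ L : ℤ, IsScriptL n L → (2 : ℤ) ∣ L ∧ ¬ (4 : ℤ) ∣ L := by
  by_cases hc : e₁ = false ∧ e₂ = false
  · obtain ⟨hδ, hX, W, hW, h1, hi⟩ := hcell hc
    exact levelTwo_of_half_class_of_invisible hGZK hmod hCM0 h12 hl hq hl8 hq8 hn hr D hPr hC hBl h hX hgen hδ hW h1 hi
  · exact levelTwo_of_lawZPlus_of_visible hGZK hmod hCM0 h12 hl hq hl8 hq8 hn hr D hPr hC hBl hi8 h (hvis hc) hgen hp0 hb0 hp hb hpb hc hlaw

end Summit.BirchSwinnertonDyer.PrintCf2.GenusPeriodKummerR2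

end
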